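import Literature.AlgebraicTopology.SingularHomology.LocalHomologyCoeffChange
import HarnessLib

/-!
# Exactness of local homology in the coefficient variable

A. Hatcher, *Algebraic Topology*, CUP 2002, §3.E p. 303 (with §2.2 p. 153): a short exact sequence
of coefficient groups `0 → A' →ᶠ A →ᵍ A'' → 0` gives a short exact sequence of singular chain
complexes "because `Cₙ(X; -) = ⨁_σ (-)` is exact", hence a long exact sequence in homology
`⋯ → Hₙ(X; A') → Hₙ(X; A) → Hₙ(X; A'') → Hₙ₋₁(X; A') → ⋯` (the Bockstein sequence), and the same
for pairs.  For the concrete local homology `Hᵢ(X | B; -)` of `…LocalHomology` and the additive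
change-of-coefficient maps `clocalHomology.coeffMap` of `…LocalHomologyCoeffChange` (which may
cross rings and universes, so that Mathlib's `ShortComplex.ShortExact` homology sequence is not
available) this file proves the two segments of that sequence which are consumed by
`…LocalHomologyCoeffSpan`, by direct diagram chases on representatives:

* `clocalHomology.exact_coeffMap` — `Hᵢ(X | B; A') → Hᵢ(X | B; A) → Hᵢ(X | B; A'')` is exact;
* `clocalHomology.coeffMap_surjective_of_isZero` — `Hᵢ(X | B; A) → Hᵢ(X | B; A'')` is onto when
  `Hᵢ₋₁(X | B; A') = 0` (the next term of the sequence);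
* the chain-level inputs: `CChain.exists_sub_mapRange_mem_chainsIn` (degreewise exactness in the
  middle of `C(X, P; A') → C(X, P; A) → C(X, P; A'')`), `CChain.mapRange_mem_chainsIn_iff`
  (an injective `f` reflects "supported in `P`"), and the lift of relative cycles along an
  injective coefficient map `clocalHomology.exists_relCls_eq_coeffMap_of_injective`.

Everything is proved; no named facts are introduced.

## References

* A. Hatcher, *Algebraic Topology*, CUP 2002, §2.2 p. 153, §3.E p. 303. [HatcherAT2002]
-/

noncomputable section

-- as in `SingularChainsConcrete`: chains of the concrete complex are `Finsupp`s up to unfolding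
set_option backward.isDefEq.respectTransparency false

open CategoryTheory Limits

universe u v v' v'' w t

namespace Literature.AlgebraicTopology.SingularHomology

/-! ### Adapters -/

section Adapters

variable {R : Type v} [CommRing R] {ι : Type t} {c : ComplexShape ι}
variable {K : HomologicalComplex (ModuleCat.{w} R) c}

/-- "Boundary modulo a subcomplex" from `c.prev j` is the same from any `i` with `c.prev j = i`.
[folklore] -/
lemma Subcomplex.exists_d_sub_mem_iff_of_prev_eq (S : Subcomplex K) {i j : ι} (h : c.prev j = i)
    (z : K.X j) :
    (∃ w : K.X (c.prev j), K.d (c.prev j) j w - z ∈ S j) ↔ ∃ w : K.X i, K.d i j w - z ∈ S j := by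
  subst h
  rfl

/-- `d ∘ d = 0` on elements. [folklore] -/
lemma HomologicalComplex.d_d_apply (K : HomologicalComplex (ModuleCat.{w} R) c) (i j k : ι)
    (x : K.X i) : K.d j k (K.d i j x) = 0 := by
  rw [← ModuleCat.comp_apply, K.d_comp_d]
  rfl

end Adapters

variable {R : Type v} [CommRing R] {R' : Type v'} [CommRing R'] {R'' : Type v''} [CommRing R'']
variable {A : Type v} [AddCommGroup A] [Module R A] {A' : Type v'} [AddCommGroup A'] [Module R' A']
  {A'' : Type v''} [AddCommGroup A''] [Module R'' A'']
variable {X : Type u} [TopologicalSpace X]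

/-! ### Chain-level exactness of coefficientwise maps modulo chains in a subspace -/

namespace CChain

/-- An injective coefficient map reflects membership in the chains of a subspace: `f ∘ c` is
supported on simplices in `P` iff `c` is (supports are preserved,
`Finsupp.support_mapRange_of_injective`). [folklore] -/
lemma mapRange_mem_chainsIn_iff {f : A' →+ A} (hf : Function.Injective f) {P : Set X} {n : ℕ}
    (c : CChain A' X n) :
    Finsupp.mapRange f (map_zero f) c ∈ chainsIn R A X P n ↔ c ∈ chainsIn R' A' X P n := by
  rw [mem_chainsIn_iff, mem_chainsIn_iff, Finsupp.support_mapRange_of_injective (map_zero f) c hf]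

/-- **Degreewise exactness in the middle of `C(X, P; A') → C(X, P; A) → C(X, P; A'')`**: if
`ker g = im f` and the chain `g ∘ c` is supported on simplices in `P`, then `c` is, modulo chains
in `P`, the image `f ∘ c'` of an `A'`-chain (Hatcher 2002, §3.E p. 303: `Cₙ(X; -) = ⨁_σ (-)`
is exact). [cite: HatcherAT2002, §3.E p. 303] -/
lemma exists_sub_mapRange_mem_chainsIn {f : A' →+ A} {g : A →+ A''} (hfg : Function.Exact f g)
    {P : Set X} {n : ℕ} (c : CChain A X n)
    (hc : Finsupp.mapRange g (map_zero g) c ∈ chainsIn R'' A'' X P n) :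
    ∃ c' : CChain A' X n, c - Finsupp.mapRange f (map_zero f) c' ∈ chainsIn R A X P n := by
  classical
  -- the part `c₁` of `c` off the simplices in `P` is killed by `g` coefficientwise
  let p : SingularSimplex X n → Prop := fun σ ↦ σ.range ⊆ P
  have hg₁ : ∀ σ, g ((c.filter fun σ ↦ ¬ p σ) σ) = 0 := by
    intro σ
    by_cases hσ : p σ
    · rw [Finsupp.filter_apply_neg (fun σ ↦ ¬ p σ) c (not_not_intro hσ), map_zero]
    · rw [Finsupp.filter_apply_pos (fun σ ↦ ¬ p σ) c hσ]
      by_contra hne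
      refine hσ ((mem_chainsIn_iff R'' A'' _).mp hc σ (Finsupp.mem_support_iff.mpr ?_))
      rwa [Finsupp.mapRange_apply]
  have hmem : (c.filter fun σ ↦ ¬ p σ) ∈
      Set.range (Finsupp.mapRange (α := SingularSimplex X n) f (map_zero f)) := by
    rw [Finsupp.range_mapRange]
    exact fun σ ↦ (hfg _).mp (hg₁ σ)
  obtain ⟨c', hc'⟩ := hmem
  refine ⟨c', ?_⟩
  rw [hc', ← eq_sub_of_add_eq (Finsupp.filter_add_filter_not c p), mem_chainsIn_iff]
  intro σ hσ
  rw [Finsupp.support_filter, Finset.mem_filter] at hσ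
  exact hσ.2

end CChain

/-! ### The two exactness statements on local homology -/

namespace clocalHomology

/-- `coeffMap g ∘ coeffMap f = 0` when `g ∘ f = 0`. [folklore] -/
lemma coeffMap_coeffMap_eq_zero {f : A' →+ A} {g : A →+ A''} (hfg : ∀ a, g (f a) = 0)
    (B : Set X) (i : ℕ) (a : clocalHomology R' A' X B i) :
    coeffMap R R'' g B i (coeffMap R' R f B i a) = 0 := by
  have h : g.comp f = 0 := AddMonoidHom.ext hfg
  rw [← coeffMap_comp_apply, h, coeffMap_zero, AddMonoidHom.zero_apply]

/-- The coefficientwise maps of a composite `g ∘ f = 0` compose to zero on chains. [folklore] -/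
lemma coeffPairMap_toFun_toFun_eq_zero {f : A' →+ A} {g : A →+ A''} (hfg : ∀ a, g (f a) = 0)
    (B : Set X) (i : ℕ) (x : (csingularChainComplex R' A' X).X i) :
    (coeffPairMap R R'' g B).toFun i ((coeffPairMap R' R f B).toFun i x) = 0 :=
  Finsupp.ext fun _ ↦ hfg _

/-- **Lift of relative cycles along an injective coefficient map.** If `f : A' → A` is injective
and a relative cycle `z` of `(X, X ∖ B)` with coefficients in `A` has all its coefficients in the
image of `f`, then `z = f ∘ z'` for a relative cycle `z'` with coefficients in `A'` (supports are
preserved), so that `[z] = f_* [z']` (Hatcher 2002, §2.2 p. 153). [folklore] -/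
theorem exists_relCls_eq_coeffMap_of_injective {f : A' →+ A} (hf : Function.Injective f)
    (B : Set X) (i : ℕ) (z : CChain A X i)
    (hz : (csingularChainComplex R A X).d i ((ComplexShape.down ℕ).next i) z ∈
      awaySub R A X B ((ComplexShape.down ℕ).next i))
    (hcoeff : ∀ σ, z σ ∈ Set.range f) :
    ∃ (z' : (csingularChainComplex R' A' X).X i)
      (hz' : (csingularChainComplex R' A' X).d i ((ComplexShape.down ℕ).next i) z' ∈
        awaySub R' A' X B ((ComplexShape.down ℕ).next i)),
      (coeffPairMap R' R f B).toFun i z' = z ∧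
        coeffMap R' R f B i ((awaySub R' A' X B).relCls z' hz') = (awaySub R A X B).relCls z hz := by
  obtain ⟨z', hz'z⟩ : ∃ z' : (csingularChainComplex R' A' X).X i,
      (coeffPairMap R' R f B).toFun i z' = z := by
    have hmem : z ∈ Set.range (Finsupp.mapRange (α := SingularSimplex X i) f (map_zero f)) := by
      rw [Finsupp.range_mapRange]; exact hcoeff
    exact hmem
  have hz' : (csingularChainComplex R' A' X).d i ((ComplexShape.down ℕ).next i) z' ∈
      awaySub R' A' X B ((ComplexShape.down ℕ).next i) := by
    refine (CChain.mapRange_mem_chainsIn_iff (R := R) hf _).mp ?_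
    change (coeffPairMap R' R f B).toFun _ _ ∈ awaySub R A X B _
    rw [(coeffPairMap R' R f B).map_d, hz'z]
    exact hz
  refine ⟨z', hz', hz'z, ?_⟩
  rw [coeffMap, Subcomplex.AddPairChainMap.homologyMap_relCls]
  exact (awaySub R A X B).relCls_congr hz'z _ _

/-- **Exactness of `Hᵢ(X | B; A') → Hᵢ(X | B; A) → Hᵢ(X | B; A'')`** for a short exact sequence
of coefficient groups `0 → A' →ᶠ A →ᵍ A'' → 0` (Hatcher 2002, §3.E p. 303, the long exact
sequence of coefficients, for the pair `(X, X ∖ B)`; here `A'`, `A`, `A''` may be modules over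
different rings in different universes, the maps being the additive `coeffMap`s).  Diagram
chase: if `[g ∘ z] = 0`, i.e. `g ∘ z = ∂w'' + s''`, lift `w'' = g ∘ w`; then `g ∘ (∂w - z)`
avoids `B`, so `∂w - z = f ∘ z' + s` with `s` avoiding `B`, and `z'` is a relative cycle (its
boundary maps under the injective `f` to `-(∂z + ∂s)`), with `f_*[z'] = -[z]`.
[cite: HatcherAT2002, §3.E p. 303] -/
theorem exact_coeffMap {f : A' →+ A} {g : A →+ A''} (hf : Function.Injective f)
    (hfg : Function.Exact f g) (hg : Function.Surjective g) (B : Set X) (i : ℕ) :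
    Function.Exact (coeffMap R' R f B i) (coeffMap R R'' g B i) := by
  intro a
  constructor
  · intro ha
    obtain ⟨z, hz, rfl⟩ := (awaySub R A X B).relCls_surjective a
    rw [coeffMap, Subcomplex.AddPairChainMap.homologyMap_relCls, Subcomplex.relCls_eq_zero_iff]
      at ha
    obtain ⟨w'', hw''⟩ := ha
    obtain ⟨w, rfl⟩ : ∃ w : (csingularChainComplex R A X).X _,
        (coeffPairMap R R'' g B).toFun _ w = w'' :=
      Finsupp.mapRange_surjective g (map_zero g) hg w''
    -- `g ∘ (∂ w - z)` avoids `B`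
    rw [← (coeffPairMap R R'' g B).map_d, ← map_sub] at hw''
    obtain ⟨z', hz's⟩ := CChain.exists_sub_mapRange_mem_chainsIn (R := R) (A' := A') (X := X) hfg
      ((csingularChainComplex R A X).d _ i w - z : (csingularChainComplex R A X).X i) hw''
    change (csingularChainComplex R A X).d _ i w - z - (coeffPairMap R' R f B).toFun i z' ∈
      awaySub R A X B i at hz's
    -- `z'` is a relative cycle
    have hfz' : (coeffPairMap R' R f B).toFun i z' = ((csingularChainComplex R A X).d _ i w - z) -
        ((csingularChainComplex R A X).d _ i w - z - (coeffPairMap R' R f B).toFun i z') :=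
      (sub_sub_cancel _ _).symm
    have hz' : (csingularChainComplex R' A' X).d i ((ComplexShape.down ℕ).next i) z' ∈
        awaySub R' A' X B ((ComplexShape.down ℕ).next i) := by
      refine (CChain.mapRange_mem_chainsIn_iff (R := R) hf _).mp ?_
      change (coeffPairMap R' R f B).toFun _ _ ∈ awaySub R A X B _
      rw [(coeffPairMap R' R f B).map_d, hfz', map_sub, map_sub, HomologicalComplex.d_d_apply,
        zero_sub]
      exact sub_mem (neg_mem hz) ((awaySub R A X B).d_mem hz's)
    refine ⟨-(awaySub R' A' X B).relCls z' hz', ?_⟩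
    rw [map_neg, neg_eq_iff_add_eq_zero, coeffMap, Subcomplex.AddPairChainMap.homologyMap_relCls,
      ← (awaySub R A X B).relCls_add _ _ _ hz (by
        rw [map_add]
        exact add_mem ((coeffPairMap R' R f B).d_toFun_mem z' hz') hz),
      Subcomplex.relCls_eq_zero_iff]
    refine ⟨w, ?_⟩
    rw [show (csingularChainComplex R A X).d _ i w - ((coeffPairMap R' R f B).toFun i z' + z) =
        (csingularChainComplex R A X).d _ i w - z - (coeffPairMap R' R f B).toFun i z' by abel]
    exact hz's
  · rintro ⟨a', rfl⟩
    exact coeffMap_coeffMap_eq_zero hfg.apply_apply_eq_zero B i a'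

/-- **`Hᵢ(X | B; A) → Hᵢ(X | B; A'')` is onto when `Hᵢ₋₁(X | B; A') = 0`**, for a short exact
sequence of coefficient groups `0 → A' →ᶠ A →ᵍ A'' → 0` (Hatcher 2002, §3.E p. 303: the segment
`Hᵢ(X, X ∖ B; A) → Hᵢ(X, X ∖ B; A'') → Hᵢ₋₁(X, X ∖ B; A')` of the long exact sequence of
coefficients is exact; in degree `0` the map is onto unconditionally).  Diagram chase: lift a
relative cycle `z''` to `z = ` a chain with `g ∘ z = z''`; `g ∘ ∂z` avoids `B`, so
`∂z = f ∘ y + s`; `y` is a relative `(i-1)`-cycle, hence `y = ∂v + s'` by the vanishing, and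
`z - f ∘ v` is a relative cycle lifting `z''`. [cite: HatcherAT2002, §3.E p. 303] -/
theorem coeffMap_surjective_of_isZero {f : A' →+ A} {g : A →+ A''} (hf : Function.Injective f)
    (hfg : Function.Exact f g) (hg : Function.Surjective g) (B : Set X) (i : ℕ)
    (hvan : ∀ j, j + 1 = i → IsZero (clocalHomology R' A' X B j)) :
    Function.Surjective (coeffMap R R'' g B i) := by
  intro a''
  obtain ⟨z'', hz'', rfl⟩ := (awaySub R'' A'' X B).relCls_surjective a''
  obtain ⟨z, rfl⟩ : ∃ z : (csingularChainComplex R A X).X i,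
      (coeffPairMap R R'' g B).toFun i z = z'' :=
    Finsupp.mapRange_surjective g (map_zero g) hg z''
  -- it suffices to correct `z` into a relative cycle with the same image under `g`
  suffices H : ∃ z₁ : (csingularChainComplex R A X).X i,
      (coeffPairMap R R'' g B).toFun i z₁ = (coeffPairMap R R'' g B).toFun i z ∧
        (csingularChainComplex R A X).d i ((ComplexShape.down ℕ).next i) z₁ ∈
          awaySub R A X B ((ComplexShape.down ℕ).next i) by
    obtain ⟨z₁, h₁, h₂⟩ := H
    refine ⟨(awaySub R A X B).relCls z₁ h₂, ?_⟩
    rw [coeffMap, Subcomplex.AddPairChainMap.homologyMap_relCls]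
    exact (awaySub R'' A'' X B).relCls_congr h₁ _ _
  cases i with
  | zero =>
    refine ⟨z, rfl, ?_⟩
    rw [(csingularChainComplex R A X).shape 0 _ (by
      rw [ChainComplex.next_nat_zero, ComplexShape.down_Rel]; omega)]
    exact Submodule.zero_mem _
  | succ j =>
    rw [ChainComplex.next_nat_succ] at hz'' ⊢
    -- `g ∘ ∂z` avoids `B`, so `∂z = f ∘ y + s`
    rw [← (coeffPairMap R R'' g B).map_d] at hz''
    obtain ⟨y, hys⟩ : ∃ y : (csingularChainComplex R' A' X).X j, _ :=
      CChain.exists_sub_mapRange_mem_chainsIn (R := R) (A' := A') (X := X) hfg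
        ((csingularChainComplex R A X).d (j + 1) j z : (csingularChainComplex R A X).X j) hz''
    change (csingularChainComplex R A X).d (j + 1) j z - (coeffPairMap R' R f B).toFun j y ∈
      awaySub R A X B j at hys
    -- `y` is a relative `j`-cycle with coefficients in `A'`
    have hy : (csingularChainComplex R' A' X).d j ((ComplexShape.down ℕ).next j) y ∈
        awaySub R' A' X B ((ComplexShape.down ℕ).next j) := by
      refine (CChain.mapRange_mem_chainsIn_iff (R := R) hf _).mp ?_
      change (coeffPairMap R' R f B).toFun _ _ ∈ awaySub R A X B _
      rw [(coeffPairMap R' R f B).map_d,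
        show (coeffPairMap R' R f B).toFun j y = (csingularChainComplex R A X).d (j + 1) j z -
          ((csingularChainComplex R A X).d (j + 1) j z - (coeffPairMap R' R f B).toFun j y) from
          (sub_sub_cancel _ _).symm,
        map_sub, HomologicalComplex.d_d_apply, zero_sub]
      exact neg_mem ((awaySub R A X B).d_mem hys)
    -- by the vanishing of `Hⱼ(X | B; A')`, `y = ∂v + s'`
    have hy0 : (awaySub R' A' X B).relCls y hy = 0 := by
      haveI := ModuleCat.subsingleton_of_isZero (hvan j rfl)
      exact Subsingleton.elim _ _
    rw [Subcomplex.relCls_eq_zero_iff,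
      (awaySub R' A' X B).exists_d_sub_mem_iff_of_prev_eq (ChainComplex.prev ℕ j)] at hy0
    obtain ⟨v, hv⟩ := hy0
    refine ⟨z - (coeffPairMap R' R f B).toFun (j + 1) v, ?_, ?_⟩
    · rw [map_sub, coeffPairMap_toFun_toFun_eq_zero hfg.apply_apply_eq_zero, sub_zero]
    · rw [map_sub, ← (coeffPairMap R' R f B).map_d,
        show (csingularChainComplex R A X).d (j + 1) j z -
            (coeffPairMap R' R f B).toFun j ((csingularChainComplex R' A' X).d (j + 1) j v) =
          ((csingularChainComplex R A X).d (j + 1) j z - (coeffPairMap R' R f B).toFun j y) -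
            (coeffPairMap R' R f B).toFun j ((csingularChainComplex R' A' X).d (j + 1) j v - y) by
          rw [map_sub]; abel]
      exact sub_mem hys ((coeffPairMap R' R f B).map_mem _ _ hv)

end clocalHomology

end Literature.AlgebraicTopology.SingularHomology
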